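import Literature.NumberTheory.DiophantineGeometry.GeomResidueFieldCharP   -- ★ `geomResidueField`, `charP_geomResidueField`
import Literature.NumberTheory.Automorphic.GaloisActionPlaces             -- ★ `instMulActionHeightOneSpectrum` (`g • w`, `smul_asIdeal`)
import Mathlib.NumberTheory.NumberField.CMField
import Mathlib.FieldTheory.Finite.Basic
import HarnessLib

/-!
# The ARITHMETIC ROWS of a finite place `w` of a number field: residue characteristic `p ∈ 𝔭_w`, `p ∈ 𝔭_{g•w}`, `N(g•w) = p^f`, `char κ̄(w) = p`
# ([NeukirchANT1999] Ch. I §8; the rows `pChar hpChar fDeg hpCharConj hfDeg charP₀` of the P6 spread carrier `PELSpreadAt`)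

Layer `Literature/NumberTheory/NumberFields`, namespace `Literature.NumberTheory.NumberFields`.  THEOREMS ONLY (no definition, no named fact, no instance,
no notation, no `sorry`).  Cell `hodgecm-mathlib` (D-0151), P6 «MOD programme», crux hLiu418 (`stmt-HodgeConjecture-24832`), P-LINE ED. 2 leaf
`Lines/F0_P6a_PELSpread.lean` socket `stub_GSPREAD` (LEAD «M-55»∕«M-55b»): the constructor of `T : PELSpreadAt … w …` must fill, at EVERY good split place `w`,
the six arithmetic rows (v6f `Lines/F0_P6a_PELInputs` :139–:150)
`pChar : ℕ`, `hpChar : Nat.Prime pChar ∧ (pChar : 𝓞 F) ∈ w.asIdeal`, `fDeg : ℕ`, `hpCharConj : (pChar : 𝓞 F) ∈ (c • w).asIdeal`,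
`hfDeg : Nat.card (𝓞 F ⧸ (c • w).asIdeal) = pChar ^ fDeg`, `charP₀ : CharP (geomResidueField w) pChar` (`c` = complex conjugation acting on the places,
★ `instMulActionHeightOneSpectrum`).  This file is the ONE-CALL organ `HeightOneSpectrum.exists_residueChar_rows g w` producing all six for any ring automorphism
`g` (B-p18 (g39) chain census step (8) «arithmetic rows»; squad «L4», seat LA4-p01 (g0)).  Elementary ([NeukirchANT1999] Ch. I §8: `𝒪_K∕𝔭` is a finite field of
characteristic `p`, `(p) = 𝔭 ∩ ℤ`, `N𝔭 = p^f`); Mathlib supplies every step (`Ideal.finiteQuotientOfFreeOfNeBot`, `CharP.exists`, `FiniteField.card`,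
`Ideal.smul_mem_pointwise_smul_iff`).  HC_CM is proved only modulo the printed citations (2 remaining named inputs hLiu418 24832, h413 24833) until rung 0 closes;
this file is count-neutral and pays no letter.

* `HeightOneSpectrum.exists_prime_natCast_mem_charP_quotient` — `∃ p, p.Prime ∧ (p : 𝓞 F) ∈ 𝔭_w ∧ CharP (𝓞 F ⧸ 𝔭_w) p`;
* `HeightOneSpectrum.charP_quotient_of_natCast_mem` — `p` prime, `p ∈ 𝔭_w` ⇒ `CharP (𝓞 F ⧸ 𝔭_w) p` (uniqueness of such `p`: ★ `eq_of_natCast_mem_asIdeal`);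
* `HeightOneSpectrum.exists_natCard_quotient_eq_pow` — `p` prime, `p ∈ 𝔭_w` ⇒ `∃ f, Nat.card (𝓞 F ⧸ 𝔭_w) = p ^ f` (and `0 < f`);
* `HeightOneSpectrum.natCast_mem_smul_asIdeal` — `n ∈ 𝔭_w ⇒ n ∈ 𝔭_{g • w}` (ring automorphisms fix `ℕ`);
* **`HeightOneSpectrum.exists_residueChar_rows`** — the six rows at once, for any `g`; `…_complexConj` — the CM-field spelling `c • w`.

## References
* [NeukirchANT1999] J. Neukirch, *Algebraic Number Theory* (1999), Ch. I §8 (Prop. (8.3): `𝒪∕𝔭` finite of characteristic `p`; residue degree `f`, `N(𝔭) = p^f`).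
* [RapoportSmithlingZhang2020Diagonal] M. Rapoport, B. Smithling, W. Zhang (2020), §4.1 (the split places `v` of `F∕F⁺` and the residue characteristic `p`).
* Tree: ★ `DiophantineGeometry/GeomResidueFieldCharP` (`charP_geomResidueField`), ★ `Automorphic/GaloisActionPlaces` (`HeightOneSpectrum.smul_asIdeal`).
-/

set_option autoImplicit false

noncomputable section

open NumberField IsDedekindDomain
open scoped Pointwise

namespace Literature.NumberTheory.NumberFields

open Literature.NumberTheory.DiophantineGeometry (geomResidueField charP_geomResidueField)

-- universe `0`: ★ `geomResidueField` (`DiophantineGeometry/AbelianVarietyOrdinaryReduction`) is typed over `K : Type`, as is the P6 carrier.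
variable {F : Type} [Field F] [NumberField F]

omit [NumberField F] in
/-- **`p ∈ 𝔭_w` with `p` prime ⇒ `𝓞 F ∕ 𝔭_w` has characteristic `p`** (`(p) = 0` in the quotient and the characteristic of the non-trivial quotient
is `0` or prime; it divides `p`). [cite: NeukirchANT1999, Ch. I §8 Prop. (8.3)] -/
theorem HeightOneSpectrum.charP_quotient_of_natCast_mem (w : HeightOneSpectrum (𝓞 F)) {p : ℕ} (hp : p.Prime) (hpw : (p : 𝓞 F) ∈ w.asIdeal) :
    CharP (𝓞 F ⧸ w.asIdeal) p := by
  haveI : w.asIdeal.IsPrime := w.isPrime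
  have h0 : (p : 𝓞 F ⧸ w.asIdeal) = 0 := by
    rw [← map_natCast (Ideal.Quotient.mk w.asIdeal) p, Ideal.Quotient.eq_zero_iff_mem]
    exact hpw
  have hdvd : ringChar (𝓞 F ⧸ w.asIdeal) ∣ p := ringChar.dvd h0
  rcases (Nat.dvd_prime hp).mp hdvd with h1 | h2
  · exact absurd h1 (CharP.ringChar_ne_one)
  · exact ringChar.eq_iff.mp h2

/-- **Every finite place lies over a rational prime**: `∃ p` prime with `p ∈ 𝔭_w`, and then `𝓞 F ∕ 𝔭_w` has characteristic `p` (the quotient is a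
finite ring; its characteristic is prime). [cite: NeukirchANT1999, Ch. I §8 Prop. (8.3)] -/
theorem HeightOneSpectrum.exists_prime_natCast_mem_charP_quotient (w : HeightOneSpectrum (𝓞 F)) :
    ∃ p : ℕ, p.Prime ∧ (p : 𝓞 F) ∈ w.asIdeal ∧ CharP (𝓞 F ⧸ w.asIdeal) p := by
  haveI : w.asIdeal.IsPrime := w.isPrime
  haveI : Finite (𝓞 F ⧸ w.asIdeal) := Ideal.finiteQuotientOfFreeOfNeBot w.asIdeal w.ne_bot
  obtain ⟨q, hq⟩ := CharP.exists (𝓞 F ⧸ w.asIdeal)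
  have hqprime : q.Prime := (CharP.char_is_prime_or_zero (𝓞 F ⧸ w.asIdeal) q).resolve_right
    (CharP.char_ne_zero_of_finite (𝓞 F ⧸ w.asIdeal) q)
  refine ⟨q, hqprime, ?_, hq⟩
  rw [← Ideal.Quotient.eq_zero_iff_mem, map_natCast]
  exact CharP.cast_eq_zero _ q

/-- **`N(𝔭_w) = p^f` with `f ≥ 1`**: for a prime `p ∈ 𝔭_w` the residue ring `𝓞 F ∕ 𝔭_w` is a finite field of characteristic `p`, so its cardinality is a
positive power of `p` (Mathlib `FiniteField.card`; `f` = the residue degree). [cite: NeukirchANT1999, Ch. I §8 Prop. (8.3)] -/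
theorem HeightOneSpectrum.exists_natCard_quotient_eq_pow (w : HeightOneSpectrum (𝓞 F)) {p : ℕ} (hp : p.Prime) (hpw : (p : 𝓞 F) ∈ w.asIdeal) :
    ∃ f : ℕ, 0 < f ∧ Nat.card (𝓞 F ⧸ w.asIdeal) = p ^ f := by
  haveI : w.asIdeal.IsMaximal := w.isMaximal
  letI : Field (𝓞 F ⧸ w.asIdeal) := Ideal.Quotient.field w.asIdeal
  haveI : Finite (𝓞 F ⧸ w.asIdeal) := Ideal.finiteQuotientOfFreeOfNeBot w.asIdeal w.ne_bot
  letI : Fintype (𝓞 F ⧸ w.asIdeal) := Fintype.ofFinite _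
  haveI := HeightOneSpectrum.charP_quotient_of_natCast_mem w hp hpw
  obtain ⟨n, -, hn⟩ := FiniteField.card (𝓞 F ⧸ w.asIdeal) p
  exact ⟨n, n.pos, by rw [Nat.card_eq_fintype_card, hn]⟩

omit [NumberField F] in
/-- **Ring automorphisms fix the rational integers**: `n ∈ 𝔭_w ⇒ n ∈ 𝔭_{g • w} = g(𝔭_w)` (`g • n = n`, Mathlib `Ideal.smul_mem_pointwise_smul_iff`).  With
`g = c` complex conjugation of a CM field: `p ∈ 𝔭_{c•w}` («`c•w ∣ p` since `c(p) = p`»). [cite: NeukirchANT1999, Ch. I §8 Prop. (8.3)] -/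
theorem HeightOneSpectrum.natCast_mem_smul_asIdeal {G : Type*} [Group G] [MulSemiringAction G (𝓞 F)] (g : G) (w : HeightOneSpectrum (𝓞 F))
    {n : ℕ} (h : (n : 𝓞 F) ∈ w.asIdeal) : (n : 𝓞 F) ∈ (g • w).asIdeal := by
  have hg : g • (n : 𝓞 F) = n := by
    rw [← MulSemiringAction.toRingHom_apply G (𝓞 F) g (n : 𝓞 F)]
    exact map_natCast _ n
  rw [Literature.NumberTheory.Automorphic.HeightOneSpectrum.smul_asIdeal, ← hg]
  exact Ideal.smul_mem_pointwise_smul_iff.mpr h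

/-- **THE SIX ARITHMETIC ROWS OF A PLACE AT ONCE** — for every ring automorphism `g` of `𝓞 F` and every finite place `w`: a prime `p` with `p ∈ 𝔭_w`
(rows `pChar`, `hpChar`), `p ∈ 𝔭_{g•w}` (`hpCharConj`), an exponent `f` with `Nat.card (𝓞 F ⧸ 𝔭_{g•w}) = p ^ f` (`fDeg`, `hfDeg`; `f ≥ 1`) and
`CharP (κ̄(w)) p` (`charP₀`, ★ `charP_geomResidueField`).  The rows :139–:150 of `PELSpreadAt` (P-LINE `F0_P6a_PELInputs`) for `g = c`.
[cite: NeukirchANT1999, Ch. I §8 Prop. (8.3)] [cite: RapoportSmithlingZhang2020Diagonal, §4.1 Thm. 4.1 (p. 17)] -/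
theorem HeightOneSpectrum.exists_residueChar_rows {G : Type*} [Group G] [MulSemiringAction G (𝓞 F)] (g : G) (w : HeightOneSpectrum (𝓞 F)) :
    ∃ p f : ℕ, (p.Prime ∧ (p : 𝓞 F) ∈ w.asIdeal) ∧ (p : 𝓞 F) ∈ (g • w).asIdeal ∧ Nat.card (𝓞 F ⧸ (g • w).asIdeal) = p ^ f ∧ 0 < f ∧
      CharP (geomResidueField w) p := by
  obtain ⟨p, hp, hpw, -⟩ := HeightOneSpectrum.exists_prime_natCast_mem_charP_quotient w
  have hpg : (p : 𝓞 F) ∈ (g • w).asIdeal := HeightOneSpectrum.natCast_mem_smul_asIdeal g w hpw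
  obtain ⟨f, hf0, hf⟩ := HeightOneSpectrum.exists_natCard_quotient_eq_pow (g • w) hp hpg
  exact ⟨p, f, ⟨hp, hpw⟩, hpg, hf, hf0, charP_geomResidueField w hp hpw⟩

/-- **The CM-field spelling** (`c • w`, `c = IsCMField.complexConj F : F ≃ₐ[F⁺] F` acting on `𝓞 F` and on the places): the rows
`pChar hpChar fDeg hpCharConj hfDeg charP₀` of `PELSpreadAt` for every finite place `w` of the CM field `F` — in the letter՚s order.
[cite: NeukirchANT1999, Ch. I §8 Prop. (8.3)] [cite: RapoportSmithlingZhang2020Diagonal, §4.1 Thm. 4.1 (p. 17)] -/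
theorem HeightOneSpectrum.exists_residueChar_rows_complexConj [IsCMField F] (w : HeightOneSpectrum (𝓞 F)) :
    ∃ (pChar : ℕ) (_ : Nat.Prime pChar ∧ (pChar : 𝓞 F) ∈ w.asIdeal) (fDeg : ℕ)
      (_ : (pChar : 𝓞 F) ∈ ((IsCMField.complexConj F) • w).asIdeal)
      (_ : Nat.card (𝓞 F ⧸ ((IsCMField.complexConj F) • w).asIdeal) = pChar ^ fDeg),
      CharP (geomResidueField w) pChar := by
  obtain ⟨p, f, hp, hpc, hf, -, hχ⟩ := HeightOneSpectrum.exists_residueChar_rows (IsCMField.complexConj F) w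
  exact ⟨p, hp, f, hpc, hf, hχ⟩

end Literature.NumberTheory.NumberFields

end
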